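import Mathlib
import HarnessLib
import Summits.KontsevichZagierPeriods.KontsevichZagierPeriods.Theorems.FermatIsogenyBetaLinearSectorGreen

/-!
# `PlanarAreas` (stmt-KontsevichZagierPeriods-4990), line `green-native-bands`: the Green glue and the engine stubs, discharged by the tree

The four open registered stubs of the PlanarAreas line `green-native-bands` (lead skeleton v3,
`Cruxes/PlanarAreas/Lines/green-native-bands.lean`; the line's other stubs AreaSlicing / Swap /
FibreDerivSemialgebraic / MixedPartials / DerivIntegrable are landed as
`Theorems/SymplecticScissorsPlanarAreasStub*.lean`) are, verbatim, theorems already in the tree, landed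
by the leads of the sibling cruxes `BetaLinearSector` (stmt-3897, line `fermat-sector-transport`) and
`GenusTwoRealPeriodCell` (stmt-17657), whose lines run the same Green chain:

* `stub_bandNewtonLeibniz_cad` = `FermatIsogeny.BetaLinearSector.stub_bandNewtonLeibniz_cad` (two-set
  adapted cylindrical decomposition, Basu–Pollack–Roy Cor. 5.7 over the proved
  `IsSemialgebraic.exists_cylindricalDecomposition_holds`);
* `stub_bandNewtonLeibniz_subband` = `IsogenyCertificates.GenusTwoRealPeriodCellLine.stub_subband` (one
  Newton–Leibniz move per closed sub-band avoiding the null set);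
* `stub_bandNewtonLeibniz` (the engine: Newton–Leibniz down a band off a null set) =
  `FermatIsogeny.BetaLinearSector.stub_bandNewtonLeibniz_of_cad_of_subband` fed with the two above;
* `stub_greenInRelations` (the glue: the typed Green generator of stmt-10042 lies in `KZ.relations`) =
  `FermatIsogeny.BetaLinearSector.greenInRelations`.

The first three are importable under those names (the gate's dedup forbids aliases; the engine is also
landed by name as `IsogenyCertificates.GenusTwoRealPeriodCellLine.stub_bandNewtonLeibniz`); this file
lands the GLUE `stub_greenInRelations` BY NAME for stmt-4990 (recorded by the lead of line
`dim-one-splice` of crux stmt-KontsevichZagierPeriods-3917, whose piece 1 consumes the same Green lemma). With `stub_areaSlicing`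
(landed) the line's composition `PlanarAreas_of : RealOnePeriodRelations → PlanarAreas` is then
sorry-free. References: M. Kontsevich, D. Zagier, *Periods* (2001), §1.2; S. Basu, R. Pollack,
M.-F. Roy, *Algorithms in Real Algebraic Geometry* (2006), Cor. 5.7.
-/

noncomputable section

open Set MeasureTheory Filter Topology
open Literature.NumberTheory.Transcendental
open Literature.ModelTheory.ExponentialFields (IsSemialgebraic)
open Summit.KontsevichZagierPeriods.SymplecticScissors.RealOnePeriodRelationsNegative (greenSet)

namespace Summit.KontsevichZagierPeriods.SymplecticScissors.PlanarAreas.GreenDischarged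

/-- **`stub_greenInRelations`** — THE GLUE (registered on stmt-4990, verbatim): every instance of the
typed Green generator of stmt-10042 lies in `KZ.relations`. The tree's Green lemma
`FermatIsogeny.BetaLinearSector.greenInRelations`, unconditional.
[cite: KontsevichZagier2001, §1.2 rules (1)–(3)] -/
theorem stub_greenInRelations : ∀ g ∈ greenSet, g ∈ KZ.relations :=
  Summit.KontsevichZagierPeriods.FermatIsogeny.BetaLinearSector.greenInRelations

end Summit.KontsevichZagierPeriods.SymplecticScissors.PlanarAreas.GreenDischarged

end
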